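import Literature.AlgebraicGeometry.Frobenioids.PerfectionRational
import Literature.AlgebraicGeometry.Frobenioids.BiratFrobeniusCompactCriterion
import Literature.AlgebraicGeometry.Frobenioids.PerfectionDivisorial
import HarnessLib

/-!
# Frobenioids I, Def. 4.5 (iii)(b) for THE perfection: a Frobenius-compact object of `((C^pf)^un-tr)^birat`
# from one rational function of `C` with non-torsion, base-invariant divisor (abc-iut cell, layer L1, node
# `FrdI:Prop5.5(iii)`, sub-DAG row `FrdI:Prop5.5(iii)/P55-L06`, slot `FrdI.Prop55Sub.Prop55iii_pf_ratStd`)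

Mochizuki, *The geometry of Frobenioids I: the general theory*, Kyushu J. Math. **62** (2008)
293–400, Def. 4.5 (iii)(b) p. 86 ("`(C^un-tr)^birat` admits a Frobenius-compact object"), Prop. 5.5 (iii)
p. 104 ll. 36–37 with proof p. 105 ll. 11–20, and the argument of Thm. 6.4 (i) p. 115 ll. 22–23 ("by
considering the effect of automorphisms of number fields on arithmetic divisors … every object of
`(C^un-tr)^birat` is Frobenius-compact"). [cite: MochizukiFrdI2008, Prop. 5.5 (iii) p.104]
[cite: MochizukiFrdI2008, Def. 4.5 (iii) p.86]

PROOF-ONLY companion (no definitions).  Clause (b) of Def. 4.5 (iii) for `C^pf` — the hypothesis `hK` of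
`FrdI.Prop55Sub.prop55iii_pf_ratStd_primarySupp_of` (`PerfectionRational.lean`) — is REDUCED to a datum on
`C`: seat abc-iut-L6-t10's criterion `Birat.exists_isFrobeniusCompact_untrBirat_of_invariant`
(`BiratFrobeniusCompactCriterion.lean`: ONE non-torsion, automorphism-invariant element of `Φ^birat(A_D)` at an
object of `C^un-tr` yields a Frobenius-compact object of `(C^un-tr)^birat`) is instantiated at the Frobenioid
`C^pf → F_{Φ^pf}` (Prop. 3.2 (iii), hypothesis `hPf`): a non-torsion `d₀ ∈ Φ^birat(A_D)` whose divisor class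
is invariant under EVERY endomorphism of `A_D` in `D` (e.g. `div(2)` in the arithmetic case) maps under
`Φ^gp → (Φ^pf)^gp` to a non-torsion (`monGpMap_perfectionOf_pow_ne_one`: `Φ → Φ^pf` reflects equality up to
torsion and `(Φ^pf)^gp` is built on a cancellative monoid), invariant (`monGpMap_perfectionOf_pullGp`) element
of `(Φ^pf)^birat(A_D)` (`map_mem_biratSubgroup_perfection`) at the object `(A, 1)` of `(C^pf)^un-tr` (isotropic:
Prop. 3.2 (iii), seat abc-iut-w5-d042 `isOfIsotropicType_toFunctor`).  Whence
`Perfection.exists_isFrobeniusCompact_untrBirat_of_invariant` and the closers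
`FrdI.Prop55Sub.prop55iii_pf_ratStd_primarySupp_of_invariant (hF) (hBi) (hd₀) (htors) (hinv)` /
`…_of_isOfIsotropicType_of_invariant (hF) (hiso) …` of the rationally-standard slot at the canonical support,
now CONDITIONAL only on data about `C` (Prop. 4.4 (ii) `hBi`, resp. isotropy, and the invariant rational
function) and on the slot's own binder `hPf`.  No statement of the paper is strengthened; nothing here bears
on [IUTchIII] Cor. 3.12.
-/

namespace Literature.AlgebraicGeometry.Frobenioids

open CategoryTheory Opposite

universe w v v' u u'

namespace PreFrobenioid

variable {D : Type u} [Category.{v} D] {Φ : Dᵒᵖ ⥤ CommMonCat.{w}}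
  {C : Type u'} [Category.{v'} C] {F : C ⥤ ElemFrobenioid Φ}

namespace Perfection

/-- Every element of `M^gp` is a fraction `a/b` of elements of `M`. [cite: MochizukiFrdI2008, §0 p.11] -/
theorem exists_mul_of_eq_of_monGp {M : Type w} [CommMonoid M] (c : Algebra.GrothendieckGroup M) :
    ∃ a b : M, c * Algebra.GrothendieckGroup.of b = Algebra.GrothendieckGroup.of a := by
  induction c using Localization.induction_on with
  | H p =>
    refine ⟨p.1, p.2, ?_⟩
    rw [Localization.mk_eq_monoidOf_mk'_apply]
    exact Submonoid.LocalizationMap.mk'_spec _ p.1 p.2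

/-- **`Φ(X)^gp → (Φ(X)^pf)^gp` carries non-torsion elements to non-torsion elements** (for the divisor monoid
of a Frobenioid): `Φ → Φ^pf` identifies only elements with a common power, and `(Φ^pf)^gp` is the group
completion of a cancellative monoid. [cite: MochizukiFrdI2008, §0 p.11] -/
theorem monGpMap_perfectionOf_pow_ne_one (hF : IsFrobenioid F) (X : D)
    {d : Algebra.GrothendieckGroup (Φ.obj (op X))} (htors : ∀ N : ℕ, 0 < N → d ^ N ≠ 1)
    (N : ℕ) (hN : 0 < N) :
    MonGp.map (Frobenioids.Perfection.of (Φ.obj (op X))) d ^ N ≠ 1 := by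
  intro h
  haveI : IsCancelMul (Φ.obj (op X)) :=
    isIntegral_iff_isCancelMul.mp (hF.isPreFrobenioid.isDivisorial X).isPreDivisorial.isIntegral
  have hc : IsCancelMul (Frobenioids.Perfection (Φ.obj (op X))) := Frobenioids.Perfection.isCancelMul
  obtain ⟨a, b, hab⟩ := exists_mul_of_eq_of_monGp (d ^ N)
  have h1 := congrArg (MonGp.map (Frobenioids.Perfection.of (Φ.obj (op X)))) hab
  rw [map_mul, map_pow, h, one_mul, MonGp.map_of, MonGp.map_of] at h1
  obtain ⟨K, hK⟩ := Frobenioids.Perfection.of_eq_of_iff.mp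
    (@Algebra.GrothendieckGroup.of_injective _ _ hc _ _ h1)
  -- `b^K = a^K`, so `(d^N)^K = of (a^K) / of (b^K) = 1`
  have h2 : (d ^ N) ^ (K : ℕ) * Algebra.GrothendieckGroup.of (b ^ (K : ℕ)) =
      Algebra.GrothendieckGroup.of (a ^ (K : ℕ)) := by
    rw [map_pow, map_pow, ← mul_pow, hab]
  rw [hK, mul_eq_right] at h2
  rw [← pow_mul] at h2
  exact htors (N * K) (Nat.mul_pos hN K.pos) h2

/-- **Def. 4.5 (iii)(b) for `C^pf` from one base-invariant rational function of `C`.**  GIVEN that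
`C^pf → F_{Φ^pf}` is a Frobenioid (Prop. 3.2 (iii), `hPf`) and `C` is of Frobenius-isotropic type: if some
object `A` of `C` carries a non-torsion `d₀ ∈ Φ^birat(A_D)` invariant under every endomorphism of `A_D`, then
`((C^pf)^un-tr)^birat` admits a Frobenius-compact object — namely the image of `(A, 1)` (seat abc-iut-L6-t10's
criterion at the perfection, fed with the image of `d₀` in `(Φ^pf)^birat(A_D)`).
[cite: MochizukiFrdI2008, Def. 4.5 (iii) p.86] -/
theorem exists_isFrobeniusCompact_untrBirat_of_invariant (hF : IsFrobenioid F)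
    (hPf : IsFrobenioid (ops hF).toFunctor) (hfi : IsOfType (IsFrobeniusIsotropic F)) {A : C}
    {d₀ : Algebra.GrothendieckGroup (Φ.obj (op (baseObj F A)))} (hd₀ : d₀ ∈ biratSubgroup F (baseObj F A))
    (htors : ∀ N : ℕ, 0 < N → d₀ ^ N ≠ 1)
    (hinv : ∀ g : baseObj F A ⟶ baseObj F A, pullGp Φ g d₀ = d₀) :
    ∃ Y : Birat (untrFunctor hPf) (isFrobenioid_untr hPf) (hasBiratSquares_untr hPf),
      (PreFrobenioidData.ofFunctor (zeroMonoid D)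
        (Birat.toElemZero (isFrobenioid_untr hPf) (hasBiratSquares_untr hPf))).IsFrobeniusCompact Y := by
  -- the object `(A, 1)` of `(C^pf)^un-tr` (isotropic in `C^pf`, Prop. 3.2 (iii))
  have hA₀ : IsIsotropic (ops hF).toFunctor ((toPf hF).obj A) := isOfIsotropicType_toFunctor hF hfi _
  have hA : (PreFrobenioidData.ofFunctor (ops hF).monFunctor (ops hF).toFunctor).IsIsotropic
      ((toPf hF).obj A) :=
    (PreFrobenioidData.ofFunctor_isIsotropic (ops hF).toFunctor _).mpr hA₀
  let A' : (PreFrobenioidData.ofFunctor (ops hF).monFunctor (ops hF).toFunctor).Untr := { as := ⟨_, hA⟩ }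
  -- the image `d₀'` of `d₀` in `(Φ^pf)^gp(A_D)`: in `(Φ^pf)^birat`, non-torsion, invariant
  have hd₀' : MonGp.map (Frobenioids.Perfection.of (Φ.obj (op (baseObj F A)))) d₀ ∈
      biratSubgroup (ops hF).toFunctor (baseObj F A) :=
    map_mem_biratSubgroup_perfection hF (baseObj F A) hd₀
  have htors' : ∀ N : ℕ, 0 < N →
      MonGp.map (Frobenioids.Perfection.of (Φ.obj (op (baseObj F A)))) d₀ ^ N ≠ 1 :=
    monGpMap_perfectionOf_pow_ne_one hF (baseObj F A) htors
  have hinv' : ∀ g : baseObj F A ⟶ baseObj F A,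
      pullGp (ops hF).monFunctor g (MonGp.map (Frobenioids.Perfection.of (Φ.obj (op (baseObj F A)))) d₀) =
        MonGp.map (Frobenioids.Perfection.of (Φ.obj (op (baseObj F A)))) d₀ := fun g =>
    (monGpMap_perfectionOf_pullGp hF g d₀).symm.trans (congrArg _ (hinv g))
  exact Birat.exists_isFrobeniusCompact_untrBirat_of_invariant hPf A' _ hd₀' htors' fun f => hinv' _

end Perfection

end PreFrobenioid

/-! ### The rationally-standard slot at the canonical support, clause (b) fed by the invariant rational function -/

namespace FrdI.Prop55Sub

open PreFrobenioid

variable {D : Type u} [Category.{v} D] {Φ : Dᵒᵖ ⥤ CommMonCat.{w}}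
  {C : Type u'} [Category.{v'} C] {F : C ⥤ ElemFrobenioid Φ}

/-- **Proposition 5.5 (iii), "rationally standard ⇒ `C^pf` rationally standard", at the canonical support,
with Def. 4.5 (iii)(b) for `C^pf` DISCHARGED from one base-invariant non-torsion rational function of `C`**
(`Perfection.exists_isFrobeniusCompact_untrBirat_of_invariant`); GIVEN Prop. 4.4 (ii) (`hBi`).  The three
clauses of Def. 4.5 (iii)(a) as in `prop55iii_pf_ratStd_primarySupp_of`.  CONDITIONAL on `hBi` and on the
datum `(A, d₀)`; Prop. 3.2 (iii) is the slot's own binder. [cite: MochizukiFrdI2008, Prop. 5.5 (iii) p.104] -/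
theorem prop55iii_pf_ratStd_primarySupp_of_invariant (hF : IsFrobenioid F)
    (hBi : IsFrobenioid (biratOps hF (hasBiratSquares_of_isFrobenioid hF)).toFunctor) {A : C}
    {d₀ : Algebra.GrothendieckGroup (Φ.obj (op (baseObj F A)))} (hd₀ : d₀ ∈ biratSubgroup F (baseObj F A))
    (htors : ∀ N : ℕ, 0 < N → d₀ ^ N ≠ 1)
    (hinv : ∀ g : baseObj F A ⟶ baseObj F A, pullGp Φ g d₀ = d₀) :
    Prop55iii_pf_ratStd F hF (fun a 𝔭 => PrimarySupp a 𝔭) (fun a 𝔭 => PrimarySupp a 𝔭) := by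
  intro hfi hfn hPf hR
  exact
    { biratFrobNormalized := PerfectionBirat.isOfBiratFrobeniusNormalizedType_biratData_perfection hPf
        (hasBiratSquares_of_isFrobenioid hPf) hBi hR.biratFrobNormalized
      rational := Perfection.isRational_perfection_of hF hPf hR.rational
      standard := prop55iii_pf_standard_of_prop55i hF hPf (fun A => prop55i_holds hF A) hfi hfn hR.standard
      frobCompact := Perfection.exists_isFrobeniusCompact_untrBirat_of_invariant hF hPf hfi hd₀ htors hinv }

/-- **The same for `C` of ISOTROPIC type**, with Prop. 4.4 (ii) discharged (seat abc-iut-w5-d227):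
`Prop55iii_pf_ratStd F hF PrimarySupp PrimarySupp` CONDITIONAL only on isotropy (print's standing hypothesis of
Def. 2.7 / 4.5 (i)) and on the base-invariant non-torsion rational function `(A, d₀)` of `C`.
[cite: MochizukiFrdI2008, Prop. 5.5 (iii) p.104] -/
theorem prop55iii_pf_ratStd_primarySupp_of_isOfIsotropicType_of_invariant (hF : IsFrobenioid F)
    (hiso : IsOfIsotropicType F) {A : C}
    {d₀ : Algebra.GrothendieckGroup (Φ.obj (op (baseObj F A)))} (hd₀ : d₀ ∈ biratSubgroup F (baseObj F A))
    (htors : ∀ N : ℕ, 0 < N → d₀ ^ N ≠ 1)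
    (hinv : ∀ g : baseObj F A ⟶ baseObj F A, pullGp Φ g d₀ = d₀) :
    Prop55iii_pf_ratStd F hF (fun a 𝔭 => PrimarySupp a 𝔭) (fun a 𝔭 => PrimarySupp a 𝔭) :=
  fun hfi hfn hPf hR =>
    prop55iii_pf_ratStd_primarySupp_of_invariant hF
      (isFrobenioid_biratData_ops_toFunctor' hF hiso fun A =>
        (isBiratFrobeniusNormalized_iff_biratData A).mpr (hR.biratFrobNormalized.obj A))
      hd₀ htors hinv hfi hfn hPf hR

end FrdI.Prop55Sub

end Literature.AlgebraicGeometry.Frobenioids
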